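import Literature.MathematicalPhysics.AQFT.StandardSubspace
import Mathlib.Analysis.Calculus.Deriv.Star
import Mathlib.Analysis.Normed.Operator.Extend
import Literature.Analysis.OperatorTheory.WeaklyHolomorphicFamily
import HarnessLib

/-!
# Inclusions of standard subspaces: the analytic family `Δ_H^{-iz} Δ_K^{iz}`

Proof companion of `Literature.MathematicalPhysics.AQFT.StandardSubspace` (R. Longo, *Lectures on
Conformal Nets I*, §2.3 "Real maps"). For standard subspaces `K ⊆ V` of a complex Hilbert space
with modular data `(Δ_K^{it}, J_K)`, `(Δ_V^{it}, J_V)` (the axiomatised structure `ModularData` of the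
base file), Longo's Corollary 2.3.2 (Theorem 2.3.1 (a) ⇒ (g) with `T = 1`) states:

> Let `K ⊂ H` be standard subspaces of `𝓗`. The map `W(s) = Δ_H^{-is} Δ_K^{is}`, `s ∈ ℝ`, extends
> to a strongly continuous map on `S̄_{1/2}`, analytic in `S_{1/2}`, such that
> `W(s + i/2) = J_H W(s) J_K`. Moreover `‖W(z)‖ ≤ 1` and `W(z + t) = Δ_H^{-it} W(z) Δ_K^{it}`.

Longo proves it with entire vectors of exponential growth for `Δ_H`, `Δ_K` and the three lines
theorem. Mathlib has no functional calculus for the unbounded `Δ`, so here the two analytic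
continuations are supplied by the `polar` axiom of the two modular data (made canonical as
`ModularData.polarExt`, the bounded continuation `z ↦ Δ^{-iz} x` of `x ∈ D(S)` to the strip
`0 ≤ Im z ≤ 1/2`): for `u ∈ D(S_V)` and `x ∈ D(S_{K'})` the scalar function
`g(z) = ⟪Δ_V^{i z̄} u, Δ_K^{iz} x⟫ = ⟪polarExt_V u (-z̄), polarExt_{K'} x z⟫` is bounded and
holomorphic on the strip, of modulus `≤ ‖u‖ ‖x‖` on both edges (on the upper edge through the
identity `⟪S_{V'} a, S_V b⟫ = ⟪b, a⟫`, Longo Prop. 2.1.2 `S_H^* = S_{H'}`), hence everywhere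
(Phragmén–Lindelöf); the operators `W(z)` are then obtained by density (`LinearMap.extendOfNorm`)
and the Riesz representation theorem. This file provides:

* elementary complements on standard subspaces (`symplComp` is antitone, `D(S_K) ⊆ D(S_V)`,
  `J_V D(S_V) = D(S_{V'})`, `S_{V'} J_V = J_V S_V`, the adjoint identity `inner_tomitaOperator_symplComp`);
* `ModularData.polarExt` and its calculus (uniqueness, linearity, covariance, edge values, norm bound);
* `ModularData.symplComp : ModularData V → ModularData V.symplComp` — the modular data
  `(Δ_V^{-it}, J_V)` of the symplectic complement (Longo Prop. 2.1.3 (c): `J_{H'} = J_H`,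
  `Δ_{H'} = Δ_H⁻¹`), CONSTRUCTED from those of `V`;
* the strip family of an inclusion `K ⊆ V` (Longo Cor. 2.3.2): the operators `inclusionFamily DK DV hKV z`
  (`= 0` off the strip) with `opNorm_inclusionFamily_le` (`‖W(z)‖ ≤ 1`), `inclusionFamily_ofReal`
  (`W(t) = Δ_V^{-it} Δ_K^{it}`), `inclusionFamily_half_I_add_ofReal_apply` (`W(t + i/2) = J_V W(t) J_K`),
  `inclusionFamily_add_ofReal` (covariance), `continuousOn_inner_inclusionFamily` (weak continuity on
  the closed strip), `differentiableOn_inclusionFamily` (operator-norm holomorphy inside, through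
  `Literature.Analysis.OperatorTheory.differentiableOn_of_forall_differentiableOn_inner`).

No named facts are introduced; all definitions have bodies (the intermediate `inclusionKernel`,
`inclusionFunctional`, `inclusionFunctionalExt`, `inclusionVec`, `inclusionPre` are the steps of the
density construction).

## References
* R. Longo, *Lectures on Conformal Nets. Part I: One Particle Structure* (2008), Prop. 2.1.2,
  Prop. 2.1.3 (c), Thm. 2.3.1, Cor. 2.3.2. [Longo2008LecturesConformalNets]
* M. A. Rieffel, A. van Daele, *A bounded operator approach to Tomita–Takesaki theory*, Pacific J.
  Math. 69 (1977), Thm. 3.8 (uniqueness of bounded analytic continuations). [RieffelVandaele1977]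
-/

noncomputable section

open Complex ComplexConjugate ClosedSubmodule Set Filter
open scoped InnerProductSpace Topology

namespace Literature.MathematicalPhysics.AQFT

variable {H : Type*} [NormedAddCommGroup H] [InnerProductSpace ℂ H]

namespace StandardSubspace

open Literature.Analysis.UnboundedOperators

/-! ### Complements on standard subspaces -/

section Basic

variable [CompleteSpace H]

/-- The symplectic complement is antitone: `K ⊆ V ⟹ V' ⊆ K'` (Longo §2.1, p. 21:
"`H₁ ⊂ H₂ ⇒ H₁' ⊃ H₂'`"). [cite: Longo2008LecturesConformalNets, §2.1 p. 21] -/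
theorem symplComp_le_symplComp_of_le {K V : StandardSubspace H}
    (h : K.toClosedSubmodule ≤ V.toClosedSubmodule) :
    V.symplComp.toClosedSubmodule ≤ K.symplComp.toClosedSubmodule := by
  intro x hx
  rw [mem_symplComp_iff'] at hx ⊢
  exact fun y hy => hx y (h hy)

/-- `V'' = V` in membership form. [cite: Longo2008LecturesConformalNets, §2.1 p. 21] -/
theorem mem_symplComp_symplComp_iff (V : StandardSubspace H) {x : H} :
    x ∈ V.symplComp.symplComp.toClosedSubmodule ↔ x ∈ V.toClosedSubmodule := by
  rw [StandardSubspace.symplComp_symplComp_eq]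

end Basic

/-- `D(S_K) ⊆ D(S_V)` for `K ⊆ V` (Longo Prop. 2.1.2, (2.1.4): `H₁ ⊂ H₂ ⇔ S_{H₁} ⊂ S_{H₂}`).
[cite: Longo2008LecturesConformalNets, Prop. 2.1.2] -/
theorem tomitaDomain_mono {K V : StandardSubspace H}
    (h : K.toClosedSubmodule ≤ V.toClosedSubmodule) : tomitaDomain K ≤ tomitaDomain V := by
  rintro _ ⟨v, hv, w, hw, rfl⟩
  exact ⟨v, h hv, w, h hw, rfl⟩

/-- `S_V = S_K` on `D(S_K)` for `K ⊆ V` (Longo Prop. 2.1.2, (2.1.4)).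
[cite: Longo2008LecturesConformalNets, Prop. 2.1.2] -/
theorem tomitaOperator_eq_of_le {K V : StandardSubspace H}
    (h : K.toClosedSubmodule ≤ V.toClosedSubmodule) (x : tomitaDomain K) :
    tomitaOperator V ⟨x, tomitaDomain_mono h x.2⟩ = tomitaOperator K x := by
  obtain ⟨v, hv, w, hw, hx⟩ := x.2
  rw [tomitaOperator_apply_eq x hv hw hx, tomitaOperator_apply_eq _ (h hv) (h hw) hx]

/-- `‖S_V x‖` is the same computed in `V` or in `K ⊆ V`. [cite: Longo2008LecturesConformalNets, Prop. 2.1.2] -/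
theorem norm_tomitaOperator_eq_of_le {K V : StandardSubspace H}
    (h : K.toClosedSubmodule ≤ V.toClosedSubmodule) (x : tomitaDomain K) :
    ‖tomitaOperator V ⟨x, tomitaDomain_mono h x.2⟩‖ = ‖tomitaOperator K x‖ := by
  rw [tomitaOperator_eq_of_le h]

namespace ModularData

variable [CompleteSpace H] {V : StandardSubspace H} (D : ModularData V)

/-- `J_V` maps `D(S_V)` into `D(S_{V'})` (`J_V V = V'`). [cite: Longo2008LecturesConformalNets, Thm. 2.1.4] -/
theorem J_apply_mem_tomitaDomain_symplComp {x : H} (hx : x ∈ tomitaDomain V) :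
    D.J x ∈ tomitaDomain V.symplComp := by
  obtain ⟨v, hv, w, hw, rfl⟩ := hx
  refine ⟨D.J v, D.J_mem v hv, (-1 : ℝ) • D.J w, SMulMemClass.smul_mem _ (D.J_mem w hw), ?_⟩
  rw [map_add, LinearIsometryEquiv.map_smulₛₗ, starRingEnd_apply, star_def, conj_I]
  simp [neg_smul]

/-- `J_V` maps `D(S_{V'})` into `D(S_V)` (`J_V V' = V`). [cite: Longo2008LecturesConformalNets, Thm. 2.1.4] -/
theorem J_apply_mem_tomitaDomain {x : H} (hx : x ∈ tomitaDomain V.symplComp) :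
    D.J x ∈ tomitaDomain V := by
  obtain ⟨v, hv, w, hw, rfl⟩ := hx
  refine ⟨D.J v, D.J_mem_of_mem_symplComp v hv, (-1 : ℝ) • D.J w,
    SMulMemClass.smul_mem _ (D.J_mem_of_mem_symplComp w hw), ?_⟩
  rw [map_add, LinearIsometryEquiv.map_smulₛₗ, starRingEnd_apply, star_def, conj_I]
  simp [neg_smul]

/-- **`S_{V'} J_V = J_V S_V`** on `D(S_V)` (Longo Prop. 2.1.3 (c), `J_{H'} = J_H`, `Δ_{H'} = Δ_H⁻¹`,
so `S_{H'} J_H = J_H Δ_H^{-1/2} J_H … `; here directly from `S (v + i w) = v − i w`).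
[cite: Longo2008LecturesConformalNets, Prop. 2.1.3 (c)] -/
theorem tomitaOperator_symplComp_J (x : tomitaDomain V) :
    tomitaOperator V.symplComp ⟨D.J x, D.J_apply_mem_tomitaDomain_symplComp x.2⟩ =
      D.J (tomitaOperator V x) := by
  obtain ⟨v, hv, w, hw, hx⟩ := x.2
  have hJ : D.J (x : H) = D.J v + I • ((-1 : ℝ) • D.J w) := by
    rw [← hx, map_add, LinearIsometryEquiv.map_smulₛₗ, starRingEnd_apply, star_def, conj_I]
    simp [neg_smul]
  rw [tomitaOperator_apply_eq _ (D.J_mem v hv) (SMulMemClass.smul_mem _ (D.J_mem w hw)) hJ.symm,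
    tomitaOperator_apply_eq x hv hw hx, map_sub, LinearIsometryEquiv.map_smulₛₗ, starRingEnd_apply,
    star_def, conj_I]
  simp [neg_smul]

/-- `S_V J_V = J_V S_{V'}` on `D(S_{V'})`. [cite: Longo2008LecturesConformalNets, Prop. 2.1.3 (c)] -/
theorem tomitaOperator_J_of_mem_symplComp (x : tomitaDomain V.symplComp) :
    tomitaOperator V ⟨D.J x, D.J_apply_mem_tomitaDomain x.2⟩ =
      D.J (tomitaOperator V.symplComp x) := by
  obtain ⟨v, hv, w, hw, hx⟩ := x.2
  have hJ : D.J (x : H) = D.J v + I • ((-1 : ℝ) • D.J w) := by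
    rw [← hx, map_add, LinearIsometryEquiv.map_smulₛₗ, starRingEnd_apply, star_def, conj_I]
    simp [neg_smul]
  rw [tomitaOperator_apply_eq _ (D.J_mem_of_mem_symplComp v hv)
      (SMulMemClass.smul_mem _ (D.J_mem_of_mem_symplComp w hw)) hJ.symm,
    tomitaOperator_apply_eq x hv hw hx, map_sub, LinearIsometryEquiv.map_smulₛₗ, starRingEnd_apply,
    star_def, conj_I]
  simp [neg_smul]

end ModularData

section Adjoint

variable [CompleteSpace H] {V : StandardSubspace H}

/-- **The adjoint identity `S_V^* ⊇ S_{V'}`** (Longo Prop. 2.1.2, eq. (2.1.5) `S_H^* = S_{H'}`, the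
inclusion proved by direct computation: "`(S_H(ξ₁+iξ₂), ξ₁'+iξ₂') = … = (S_{H'}(ξ₁'+iξ₂'), ξ₁+iξ₂)`"):
for `a ∈ D(S_{V'})` and `b ∈ D(S_V)`, `⟪S_{V'} a, S_V b⟫ = ⟪b, a⟫`.
[cite: Longo2008LecturesConformalNets, Prop. 2.1.2] -/
theorem inner_tomitaOperator_symplComp_tomitaOperator (a : tomitaDomain V.symplComp)
    (b : tomitaDomain V) :
    ⟪tomitaOperator V.symplComp a, tomitaOperator V b⟫_ℂ = ⟪(b : H), (a : H)⟫_ℂ := by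
  obtain ⟨a₁, ha₁, a₂, ha₂, ha⟩ := a.2
  obtain ⟨b₁, hb₁, b₂, hb₂, hb⟩ := b.2
  rw [tomitaOperator_apply_eq a ha₁ ha₂ ha, tomitaOperator_apply_eq b hb₁ hb₂ hb, ← ha, ← hb]
  -- all the pairings `⟪aᵢ, bⱼ⟫` are real, hence symmetric
  have hr : ∀ {p q : H}, p ∈ V.symplComp.toClosedSubmodule → q ∈ V.toClosedSubmodule →
      ⟪p, q⟫_ℂ = ⟪q, p⟫_ℂ := by
    intro p q hp hq
    have him := im_inner_eq_zero_of_mem_symplComp_of_mem V hp hq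
    rw [← inner_conj_symm, conj_eq_iff_im, ← inner_conj_symm, conj_im, him, neg_zero]
  simp only [inner_add_left, inner_add_right, inner_sub_left, inner_sub_right, inner_smul_left,
    inner_smul_right, conj_I]
  rw [hr ha₁ hb₁, hr ha₁ hb₂, hr ha₂ hb₁, hr ha₂ hb₂]
  ring

end Adjoint

/-! ### The canonical analytic continuation `z ↦ Δ^{-iz} x` on the strip `0 ≤ Im z ≤ 1/2` -/

namespace ModularData

variable [CompleteSpace H] {V : StandardSubspace H} (D : ModularData V)

/-- **The bounded analytic continuation `polarExt D x z = Δ_V^{-iz} x`** of the orbit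
`t ↦ Δ_V^{-it} x` of `x ∈ D(S_V)` to the closed strip `0 ≤ Im z ≤ 1/2` (the function provided by
the `polar` axiom, which is unique by `eq_zero_of_eq_zero_on_real`), extended by `0` off the strip.
[cite: Longo2008LecturesConformalNets, Prop. 2.1.3 (polar decomposition)] -/
def polarExt (x : tomitaDomain V) : ℂ → H :=
  (closedStrip 2⁻¹).indicator (Classical.choose (D.polar x))

/-- On the strip `polarExt` is the chosen continuation. [folklore] -/
theorem polarExt_eq_of_mem (x : tomitaDomain V) {z : ℂ} (hz : z ∈ closedStrip 2⁻¹) :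
    D.polarExt x z = Classical.choose (D.polar x) z := by
  rw [polarExt, Set.indicator_of_mem hz]

/-- Off the strip `polarExt` vanishes. [folklore] -/
theorem polarExt_of_not_mem (x : tomitaDomain V) {z : ℂ} (hz : z ∉ closedStrip 2⁻¹) :
    D.polarExt x z = 0 := by
  rw [polarExt, Set.indicator_of_notMem hz]

/-- `polarExt` is continuous on the closed strip. [cite: Longo2008LecturesConformalNets, Prop. 2.1.3] -/
theorem continuousOn_polarExt (x : tomitaDomain V) : ContinuousOn (D.polarExt x) (closedStrip 2⁻¹) :=
  (Classical.choose_spec (D.polar x)).1.congr fun _ hz => D.polarExt_eq_of_mem x hz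

/-- `polarExt` is holomorphic on the open strip. [cite: Longo2008LecturesConformalNets, Prop. 2.1.3] -/
theorem differentiableOn_polarExt (x : tomitaDomain V) :
    DifferentiableOn ℂ (D.polarExt x) (openStrip 2⁻¹) :=
  (Classical.choose_spec (D.polar x)).2.1.congr fun _ hz =>
    D.polarExt_eq_of_mem x (openStrip_subset_closedStrip _ hz)

/-- Real values: `polarExt D x t = Δ^{-it} x`. [cite: Longo2008LecturesConformalNets, Prop. 2.1.3] -/
theorem polarExt_ofReal (x : tomitaDomain V) (t : ℝ) : D.polarExt x t = D.U.appReal (-t) x := by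
  rw [D.polarExt_eq_of_mem x (by rw [mem_closedStrip_iff, ofReal_im]; norm_num)]
  exact (Classical.choose_spec (D.polar x)).2.2.2.1 t

/-- `polarExt D x 0 = x`. [folklore] -/
theorem polarExt_zero (x : tomitaDomain V) : D.polarExt x 0 = x := by
  have h := D.polarExt_ofReal x 0
  rw [ofReal_zero] at h
  rw [h, neg_zero, UnitaryRep.appReal_zero, one_apply_eq_self]

/-- **The value at `i/2`: `polarExt D x (i/2) = Δ^{1/2} x = J_V S_V x`** (polar decomposition).
[cite: Longo2008LecturesConformalNets, Prop. 2.1.3] -/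
theorem polarExt_half_I (x : tomitaDomain V) :
    D.polarExt x ((2⁻¹ : ℂ) * I) = D.J (tomitaOperator V x) := by
  rw [D.polarExt_eq_of_mem x half_I_mem_closedStrip]
  exact (Classical.choose_spec (D.polar x)).2.2.2.2

/-- The chosen bound of `polarExt` on the closed strip. [folklore] -/
theorem exists_forall_norm_polarExt_le (x : tomitaDomain V) :
    ∃ C : ℝ, ∀ z ∈ closedStrip 2⁻¹, ‖D.polarExt x z‖ ≤ C := by
  obtain ⟨C, hC⟩ := (Classical.choose_spec (D.polar x)).2.2.1
  exact ⟨C, fun z hz => by rw [D.polarExt_eq_of_mem x hz]; exact hC z hz⟩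

/-- **Uniqueness of the continuation**: any bounded continuous function on the closed strip,
holomorphic inside, which agrees with `t ↦ Δ^{-it} x` on the real line is `polarExt D x` there
(Rieffel–van Daele 1977, remark after Def. 3.4). [cite: RieffelVandaele1977, §3 remark after Def. 3.4] -/
theorem eq_polarExt_of_forall_ofReal (x : tomitaDomain V) {G : ℂ → H}
    (hc : ContinuousOn G (closedStrip 2⁻¹)) (hd : DifferentiableOn ℂ G (openStrip 2⁻¹))
    (hb : ∃ C : ℝ, ∀ z ∈ closedStrip 2⁻¹, ‖G z‖ ≤ C) (ht : ∀ t : ℝ, G t = D.U.appReal (-t) x)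
    {z : ℂ} (hz : z ∈ closedStrip 2⁻¹) : G z = D.polarExt x z := by
  obtain ⟨C₁, hC₁⟩ := hb
  obtain ⟨C₂, hC₂⟩ := D.exists_forall_norm_polarExt_le x
  have h := eq_zero_of_eq_zero_on_real (by norm_num : (0 : ℝ) < 2⁻¹) (hd.sub (D.differentiableOn_polarExt x))
    (hc.sub (D.continuousOn_polarExt x)) (M := C₁ + C₂)
    (fun w hw => (norm_sub_le _ _).trans (add_le_add (hC₁ w hw) (hC₂ w hw)))
    (fun s => by simp only [Pi.sub_apply, ht, polarExt_ofReal, sub_self]) z hz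
  exact sub_eq_zero.1 h

/-- **Covariance `Δ^{-i(z+s)} x = Δ^{-is} Δ^{-iz} x`** on the closed strip.
[cite: RieffelVandaele1977, Thm. 3.8 (proof)] -/
theorem polarExt_add_ofReal (x : tomitaDomain V) (s : ℝ) {z : ℂ} (hz : z ∈ closedStrip 2⁻¹) :
    D.polarExt x (z + s) = D.U.appReal (-s) (D.polarExt x z) :=
  D.polar_covariance (D.continuousOn_polarExt x) (D.differentiableOn_polarExt x)
    (D.exists_forall_norm_polarExt_le x) (D.polarExt_ofReal x) s hz

/-- Values on the upper edge: `Δ^{-i(t + i/2)} x = Δ^{-it} J_V S_V x`. [cite: RieffelVandaele1977, Thm. 3.8 (proof)] -/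
theorem polarExt_ofReal_add_half_I (x : tomitaDomain V) (t : ℝ) :
    D.polarExt x ((2⁻¹ : ℂ) * I + t) = D.U.appReal (-t) (D.J (tomitaOperator V x)) := by
  rw [D.polarExt_add_ofReal x t half_I_mem_closedStrip, polarExt_half_I]

/-- **Additivity in the vector**: `Δ^{-iz}(x + y) = Δ^{-iz} x + Δ^{-iz} y` (uniqueness of the
continuation). [folklore] -/
theorem polarExt_add (x y : tomitaDomain V) (z : ℂ) :
    D.polarExt (x + y) z = D.polarExt x z + D.polarExt y z := by
  by_cases hz : z ∈ closedStrip 2⁻¹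
  · symm
    refine D.eq_polarExt_of_forall_ofReal (x + y) ((D.continuousOn_polarExt x).add
      (D.continuousOn_polarExt y)) ((D.differentiableOn_polarExt x).add (D.differentiableOn_polarExt y))
      ?_ (fun t => ?_) hz
    · obtain ⟨C₁, hC₁⟩ := D.exists_forall_norm_polarExt_le x
      obtain ⟨C₂, hC₂⟩ := D.exists_forall_norm_polarExt_le y
      exact ⟨C₁ + C₂, fun w hw => (norm_add_le _ _).trans (add_le_add (hC₁ w hw) (hC₂ w hw))⟩
    · simp only [Pi.add_apply, polarExt_ofReal, Submodule.coe_add, map_add]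
  · simp only [D.polarExt_of_not_mem _ hz, add_zero]

/-- **Homogeneity in the vector**: `Δ^{-iz}(c x) = c Δ^{-iz} x`. [folklore] -/
theorem polarExt_smul (c : ℂ) (x : tomitaDomain V) (z : ℂ) :
    D.polarExt (c • x) z = c • D.polarExt x z := by
  by_cases hz : z ∈ closedStrip 2⁻¹
  · symm
    refine D.eq_polarExt_of_forall_ofReal (c • x) ((D.continuousOn_polarExt x).const_smul c)
      ((D.differentiableOn_polarExt x).const_smul c) ?_ (fun t => ?_) hz
    · obtain ⟨C, hC⟩ := D.exists_forall_norm_polarExt_le x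
      exact ⟨‖c‖ * C, fun w hw => by rw [Pi.smul_apply, norm_smul]; gcongr; exact hC w hw⟩
    · simp only [Pi.smul_apply, polarExt_ofReal, Submodule.coe_smul, map_smul]
  · simp only [D.polarExt_of_not_mem _ hz, smul_zero]

/-- `Δ^{-iz}` of the zero vector is zero. [folklore] -/
theorem polarExt_zero_left (z : ℂ) : D.polarExt 0 z = 0 := by
  have h := D.polarExt_smul 0 0 z
  rwa [zero_smul, zero_smul] at h

/-- `Δ^{-iz}(x - y) = Δ^{-iz} x - Δ^{-iz} y`. [folklore] -/
theorem polarExt_sub (x y : tomitaDomain V) (z : ℂ) :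
    D.polarExt (x - y) z = D.polarExt x z - D.polarExt y z := by
  rw [sub_eq_add_neg, D.polarExt_add, ← neg_one_smul ℂ y, D.polarExt_smul, neg_one_smul,
    ← sub_eq_add_neg]

/-- **`Δ^{it}` commutes with the continuation**: `Δ^{-iz} Δ^{it} x = Δ^{it} Δ^{-iz} x`. [folklore] -/
theorem polarExt_U (t : ℝ) (x : tomitaDomain V) (z : ℂ) :
    D.polarExt ⟨D.U.appReal t x, D.U_apply_mem_tomitaDomain t x.2⟩ z =
      D.U.appReal t (D.polarExt x z) := by
  by_cases hz : z ∈ closedStrip 2⁻¹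
  · symm
    refine D.eq_polarExt_of_forall_ofReal _
      ((D.U.appReal t).continuous.comp_continuousOn (D.continuousOn_polarExt x))
      ((D.U.appReal t).differentiable.comp_differentiableOn (D.differentiableOn_polarExt x))
      ?_ (fun s => ?_) hz
    · obtain ⟨C, hC⟩ := D.exists_forall_norm_polarExt_le x
      exact ⟨C, fun w hw => by rw [Function.comp_apply, norm_U_apply]; exact hC w hw⟩
    · rw [Function.comp_apply, polarExt_ofReal, ← mul_apply_eq_comp, ← mul_apply_eq_comp,
        ← UnitaryRep.appReal_add, ← UnitaryRep.appReal_add, add_comm]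
  · simp only [D.polarExt_of_not_mem _ hz, map_zero]

/-- **Norm bound on the strip**: `‖Δ^{-iz} x‖ ≤ ‖x‖ + ‖S_V x‖` for `0 ≤ Im z ≤ 1/2` (Phragmén–Lindelöf:
the edge values are `Δ^{-it} x` and `Δ^{-it} J S x`). [cite: Longo2008LecturesConformalNets, Thm. 2.3.1 (2.3.2)] -/
theorem norm_polarExt_le (x : tomitaDomain V) (z : ℂ) :
    ‖D.polarExt x z‖ ≤ ‖(x : H)‖ + ‖tomitaOperator V x‖ := by
  by_cases hz : z ∈ closedStrip 2⁻¹
  · obtain ⟨C, hC⟩ := D.exists_forall_norm_polarExt_le x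
    refine norm_le_of_forall_mem_edges_strip (by norm_num : (0 : ℝ) < 2⁻¹) (D.differentiableOn_polarExt x)
      (D.continuousOn_polarExt x) hC (fun w hw => ?_) (fun w hw => ?_) hz
    · obtain ⟨s, rfl⟩ : ∃ s : ℝ, (s : ℂ) = w := ⟨w.re, Complex.ext (by simp) (by simp [hw])⟩
      rw [polarExt_ofReal, norm_U_apply]
      exact le_add_of_nonneg_right (norm_nonneg _)
    · obtain ⟨s, rfl⟩ : ∃ s : ℝ, (2⁻¹ : ℂ) * I + s = w :=
        ⟨w.re, Complex.ext (by simp) (by rw [add_im, half_I_im, ofReal_im, add_zero, hw])⟩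
      rw [polarExt_ofReal_add_half_I, norm_U_apply, LinearIsometryEquiv.norm_map]
      exact le_add_of_nonneg_left (norm_nonneg _)
  · rw [D.polarExt_of_not_mem x hz, norm_zero]
    positivity

/-- `polarExt` is continuous on the closed strip as a function into `H`, restated with `Set.MapsTo`
for compositions: continuity of `z ↦ Δ^{-iφ(z)} x` for continuous `φ` mapping into the strip. [folklore] -/
theorem continuousOn_polarExt_comp (x : tomitaDomain V) {s : Set ℂ} {φ : ℂ → ℂ}
    (hφ : ContinuousOn φ s) (hmaps : MapsTo φ s (closedStrip 2⁻¹)) :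
    ContinuousOn (fun z => D.polarExt x (φ z)) s :=
  (D.continuousOn_polarExt x).comp hφ hmaps

end ModularData

/-! ### Reflected continuations `z ↦ J (G (-z̄))` -/

section Reflect

variable [CompleteSpace H]

/-- The reflection `z ↦ -z̄` preserves the closed strip. [folklore] -/
theorem neg_conj_mem_closedStrip_iff {a : ℝ} {z : ℂ} : -conj z ∈ closedStrip a ↔ z ∈ closedStrip a := by
  simp [mem_closedStrip_iff]

/-- The reflection `z ↦ -z̄` preserves the open strip. [folklore] -/
theorem neg_conj_mem_openStrip_iff {a : ℝ} {z : ℂ} : -conj z ∈ openStrip a ↔ z ∈ openStrip a := by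
  simp [mem_openStrip_iff]

/-- `z ↦ -z̄` is continuous. [folklore] -/
theorem continuous_neg_conj : Continuous fun z : ℂ => -conj z :=
  continuous_conj.neg

omit [CompleteSpace H] in
/-- **Holomorphy of `z ↦ J (G (-z̄))`** for an antiunitary `J` and a holomorphic `G`: the two
conjugate-linearities cancel (Mathlib `DifferentiableAt.comp_semilinear₂`). [folklore] -/
theorem differentiableOn_antiunitary_reflect (J : H ≃ₗᵢ⋆[ℂ] H) {G : ℂ → H} {s : Set ℂ}
    (hs : IsOpen s) (hG : DifferentiableOn ℂ G s) :
    DifferentiableOn ℂ (fun z => J (G (-conj z))) {z | -conj z ∈ s} := by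
  intro z hz
  have hd : DifferentiableAt ℂ G (-conj z) := hG.differentiableAt (hs.mem_nhds hz)
  set R : ℂ →SL[starRingEnd ℂ] ℂ := -((starL ℂ : ℂ ≃L⋆[ℂ] ℂ) : ℂ →SL[starRingEnd ℂ] ℂ) with hR
  have hRz : ∀ w : ℂ, R w = -conj w := fun w => rfl
  have hd' : DifferentiableAt ℂ G (R z) := by rw [hRz]; exact hd
  have h := hd'.comp_semilinear₂ (J.toContinuousLinearEquiv : H →SL[starRingEnd ℂ] H) R
  have heq : ((J.toContinuousLinearEquiv : H →SL[starRingEnd ℂ] H) ∘ G ∘ R) =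
      fun w => J (G (-conj w)) := by
    funext w
    simp only [Function.comp_apply, hRz]
    rfl
  rw [heq] at h
  exact h.differentiableWithinAt

omit [CompleteSpace H] in
/-- Continuity of `z ↦ J (G (-z̄))` on the reflected set. [folklore] -/
theorem continuousOn_antiunitary_reflect (J : H ≃ₗᵢ⋆[ℂ] H) {G : ℂ → H} {s : Set ℂ}
    (hG : ContinuousOn G s) : ContinuousOn (fun z => J (G (-conj z))) {z | -conj z ∈ s} :=
  J.continuous.comp_continuousOn (hG.comp continuous_neg_conj.continuousOn fun _ hz => hz)

end Reflect

/-! ### The modular data of the symplectic complement -/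

namespace ModularData

variable [CompleteSpace H] {V : StandardSubspace H} (D : ModularData V)

/-- Inversion `t ↦ -t` of `Multiplicative ℝ` as a continuous monoid homomorphism. [folklore] -/
def invRealHom : Multiplicative ℝ →ₜ* Multiplicative ℝ where
  toFun g := g⁻¹
  map_one' := inv_one
  map_mul' a b := mul_inv a b
  continuous_toFun := continuous_inv

/-- The time-reversed modular group `t ↦ Δ_V^{-it}` (the modular group of `V'`,
`Δ_{H'} = Δ_H⁻¹`, Longo Prop. 2.1.3 (c)). [cite: Longo2008LecturesConformalNets, Prop. 2.1.3 (c)] -/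
def reversedU : OneParameterUnitaryGroup H := D.U.restrict invRealHom

/-- `reversedU t = Δ^{-it}`. [cite: Longo2008LecturesConformalNets, Prop. 2.1.3 (c)] -/
@[simp]
theorem reversedU_appReal (t : ℝ) : D.reversedU.appReal t = D.U.appReal (-t) := rfl

/-- The KMS/polar reflection `z ↦ conj (F (-z̄))` of a scalar function is holomorphic where `F` is.
[folklore] -/
theorem differentiableOn_conj_reflect {F : ℂ → ℂ} {s : Set ℂ} (hs : IsOpen s)
    (hF : DifferentiableOn ℂ F s) : DifferentiableOn ℂ (fun z => conj (F (-conj z))) {z | -conj z ∈ s} := by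
  intro z hz
  have hd : DifferentiableAt ℂ F (-conj z) := hF.differentiableAt (hs.mem_nhds hz)
  have h1 : DifferentiableAt ℂ (fun w => F (-w)) (conj z) := by
    have : DifferentiableAt ℂ (fun w : ℂ => -w) (conj z) := differentiableAt_id.neg
    exact hd.comp (conj z) this
  have h2 := h1.conj_conj
  rw [conj_conj] at h2
  exact h2.differentiableWithinAt

/-- **The modular data of the symplectic complement `V'`**: modular group `t ↦ Δ_V^{-it}`, the same
conjugation `J_V` (Longo Prop. 2.1.3 (c): "`J_{H'} = J_H` and `Δ_{H'} = Δ_H⁻¹`"), with the polar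
continuation `z ↦ J_V (Δ_V^{-i(-z̄)} J_V x)` and the KMS functions `z ↦ conj F(-z̄)`; constructed, so
that the base file's uniqueness theorem identifies it with THE modular data of `V'`.
[cite: Longo2008LecturesConformalNets, Prop. 2.1.3 (c)] -/
def symplComp : ModularData V.symplComp where
  U := D.reversedU
  J := D.J
  J_J := D.J_J
  J_U t x := by simp only [reversedU_appReal, D.J_U]
  U_mem t x hx := by
    rw [reversedU_appReal]
    exact D.U_mem_symplComp (-t) hx
  J_mem x hx := (mem_symplComp_symplComp_iff V).2 (D.J_mem_of_mem_symplComp x hx)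
  J_mem_of_mem_symplComp x hx := D.J_mem x ((mem_symplComp_symplComp_iff V).1 hx)
  re_inner_J_nonneg x hx := by
    have h := D.re_inner_J_nonneg (D.J x) (D.J_mem_of_mem_symplComp x hx)
    rwa [D.J_J, ← inner_conj_symm, conj_re] at h
  polar x := by
    set y : tomitaDomain V := ⟨D.J x, D.J_apply_mem_tomitaDomain x.2⟩ with hy
    refine ⟨fun z => D.J (D.polarExt y (-conj z)), ?_, ?_, ?_, ?_, ?_⟩
    · refine (continuousOn_antiunitary_reflect D.J (D.continuousOn_polarExt y)).mono ?_
      intro z hz; exact neg_conj_mem_closedStrip_iff.2 hz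
    · refine (differentiableOn_antiunitary_reflect D.J (isOpen_openStrip _)
        (D.differentiableOn_polarExt y)).mono ?_
      intro z hz; exact neg_conj_mem_openStrip_iff.2 hz
    · exact ⟨‖(y : H)‖ + ‖tomitaOperator V y‖, fun z _ => by
        rw [LinearIsometryEquiv.norm_map]; exact D.norm_polarExt_le y _⟩
    · intro t
      dsimp only
      rw [conj_ofReal, ← ofReal_neg, polarExt_ofReal, neg_neg, D.J_U, hy, D.J_J, reversedU_appReal,
        neg_neg]
    · dsimp only
      have h : -conj ((2⁻¹ : ℂ) * I) = (2⁻¹ : ℂ) * I := by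
        rw [map_mul, conj_I, show conj (2⁻¹ : ℂ) = 2⁻¹ by
          rw [show (2⁻¹ : ℂ) = ((2⁻¹ : ℝ) : ℂ) by push_cast; ring, conj_ofReal]]
        ring
      rw [h, polarExt_half_I, D.J_J]
      exact D.tomitaOperator_J_of_mem_symplComp x
  kms ξ hξ η hη := by
    obtain ⟨F, hc, hd, ⟨C, hC⟩, h₀, h₁⟩ := D.kms (D.J ξ) (D.J_mem_of_mem_symplComp ξ hξ) (D.J η)
      (D.J_mem_of_mem_symplComp η hη)
    refine ⟨fun z => conj (F (-conj z)), ?_, ?_, ⟨C, fun z hz => ?_⟩, fun t => ?_, fun t => ?_⟩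
    · refine (continuous_conj.comp_continuousOn (hc.comp continuous_neg_conj.continuousOn ?_))
      intro z hz; exact neg_conj_mem_closedStrip_iff.2 hz
    · exact (differentiableOn_conj_reflect (isOpen_openStrip 1) hd).mono fun z hz =>
        neg_conj_mem_openStrip_iff.2 hz
    · dsimp only
      rw [RCLike.norm_conj]
      exact hC _ (neg_conj_mem_closedStrip_iff.2 hz)
    · dsimp only
      rw [conj_ofReal, ← ofReal_neg, h₀, reversedU_appReal, neg_neg, ← D.J_U, inner_J_J,
        inner_conj_symm]
    · dsimp only
      have h : -conj ((t : ℂ) + I) = ((-t : ℝ) : ℂ) + I := by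
        rw [map_add, conj_ofReal, conj_I]; push_cast; ring
      rw [h, h₁, reversedU_appReal, neg_neg, ← D.J_U, inner_J_J, inner_conj_symm]

/-- The modular group of `V'` is `t ↦ Δ_V^{-it}`. [cite: Longo2008LecturesConformalNets, Prop. 2.1.3 (c)] -/
@[simp]
theorem symplComp_U_appReal (t : ℝ) : D.symplComp.U.appReal t = D.U.appReal (-t) := rfl

/-- The modular conjugation of `V'` is `J_V`. [cite: Longo2008LecturesConformalNets, Prop. 2.1.3 (c)] -/
@[simp]
theorem symplComp_J : D.symplComp.J = D.J := rfl

end ModularData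

/-! ### The scalar kernel `⟪Δ_V^{i z̄} u, Δ_K^{iz} x⟫` of an inclusion `K ⊆ V` -/

section Kernel

variable [CompleteSpace H] {K V : StandardSubspace H} (DK : ModularData K) (DV : ModularData V)

/-- The scalar kernel `g_{u,x}(z) = ⟪Δ_V^{i z̄} u, Δ_K^{iz} x⟫ = ⟪Δ_V^{-i(-z̄)} u, Δ_{K'}^{-iz} x⟫`,
`u ∈ D(S_V)`, `x ∈ D(S_{K'})`, of the family `W(z) = Δ_V^{-iz} Δ_K^{iz}` (Longo, proof of
Thm. 2.3.1 (f) ⇒ (g): "`f_{ξ,η}(z) ≡ (Δ_H^{-iz} T Δ_K^{iz} η, ξ) = (T Δ_K^{iz} η, Δ_H^{-i z̄} ξ)`",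
`T = 1`). [cite: Longo2008LecturesConformalNets, Thm. 2.3.1 (proof)] -/
def inclusionKernel (u : tomitaDomain V) (x : tomitaDomain K.symplComp) (z : ℂ) : ℂ :=
  ⟪DV.polarExt u (-conj z), DK.symplComp.polarExt x z⟫_ℂ

variable {DK DV}

/-- The kernel through the antiunitary `J_V`: `g(z) = ⟪J_V Δ_{K'}^{-iz} x, J_V Δ_V^{-i(-z̄)} u⟫`
(both slots holomorphic in this form). [folklore] -/
theorem inclusionKernel_eq_inner_J (u : tomitaDomain V) (x : tomitaDomain K.symplComp) (z : ℂ) :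
    inclusionKernel DK DV u x z =
      ⟪DV.J (DK.symplComp.polarExt x z), DV.J (DV.polarExt u (-conj z))⟫_ℂ := by
  rw [inclusionKernel, DV.inner_J_J]

/-- The kernel is holomorphic on the open strip. [cite: Longo2008LecturesConformalNets, Thm. 2.3.1 (proof)] -/
theorem differentiableOn_inclusionKernel (u : tomitaDomain V) (x : tomitaDomain K.symplComp) :
    DifferentiableOn ℂ (inclusionKernel DK DV u x) (openStrip 2⁻¹) := by
  have heq : inclusionKernel DK DV u x = fun z =>
      ((innerSL ℂ (E := H)).comp DV.J.toLinearIsometry.toContinuousLinearMap)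
        (DK.symplComp.polarExt x z) (DV.J (DV.polarExt u (-conj z))) := by
    funext z; exact inclusionKernel_eq_inner_J u x z
  rw [heq]
  refine ((ContinuousLinearMap.differentiable _).comp_differentiableOn
    (DK.symplComp.differentiableOn_polarExt x)).clm_apply ?_
  exact (differentiableOn_antiunitary_reflect DV.J (isOpen_openStrip _)
    (DV.differentiableOn_polarExt u)).mono fun z hz => neg_conj_mem_openStrip_iff.2 hz

/-- The kernel is continuous on the closed strip. [cite: Longo2008LecturesConformalNets, Thm. 2.3.1 (proof)] -/
theorem continuousOn_inclusionKernel (u : tomitaDomain V) (x : tomitaDomain K.symplComp) :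
    ContinuousOn (inclusionKernel DK DV u x) (closedStrip 2⁻¹) := by
  refine ContinuousOn.inner ?_ (DK.symplComp.continuousOn_polarExt x)
  exact (DV.continuousOn_polarExt u).comp continuous_neg_conj.continuousOn
    fun z hz => neg_conj_mem_closedStrip_iff.2 hz

/-- A priori bound of the kernel on the closed strip. [folklore] -/
theorem norm_inclusionKernel_le_aux (u : tomitaDomain V) (x : tomitaDomain K.symplComp) (z : ℂ) :
    ‖inclusionKernel DK DV u x z‖ ≤ (‖(u : H)‖ + ‖tomitaOperator V u‖) *
      (‖(x : H)‖ + ‖tomitaOperator K.symplComp x‖) :=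
  (norm_inner_le_norm _ _).trans (mul_le_mul (DV.norm_polarExt_le u _)
    (DK.symplComp.norm_polarExt_le x _) (norm_nonneg _) (by positivity))

/-- The kernel vanishes off the closed strip. [folklore] -/
theorem inclusionKernel_of_not_mem (u : tomitaDomain V) (x : tomitaDomain K.symplComp) {z : ℂ}
    (hz : z ∉ closedStrip 2⁻¹) : inclusionKernel DK DV u x z = 0 := by
  rw [inclusionKernel, DK.symplComp.polarExt_of_not_mem x hz, inner_zero_right]

/-- **Real values of the kernel**: `g(t) = ⟪u, Δ_V^{-it} Δ_K^{it} x⟫`.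
[cite: Longo2008LecturesConformalNets, Cor. 2.3.2] -/
theorem inclusionKernel_ofReal (u : tomitaDomain V) (x : tomitaDomain K.symplComp) (t : ℝ) :
    inclusionKernel DK DV u x t = ⟪(u : H), DV.U.appReal (-t) (DK.U.appReal t x)⟫_ℂ := by
  rw [inclusionKernel, conj_ofReal, ← ofReal_neg, DV.polarExt_ofReal, DK.symplComp.polarExt_ofReal,
    neg_neg, DK.symplComp_U_appReal, neg_neg, ModularData.inner_appReal_right_eq DV.U (-t), neg_neg]

/-- **Upper-edge values of the kernel**: `g(t + i/2) = ⟪u, J_V Δ_V^{-it} Δ_K^{it} J_K x⟫`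
(through `⟪S_{V'} a, S_V b⟫ = ⟪b, a⟫` and `S_K ⊆ S_V`; Longo, proof of Thm. 2.3.1, (2.3.5)).
[cite: Longo2008LecturesConformalNets, Thm. 2.3.1 (proof)] -/
theorem inclusionKernel_half_I_add_ofReal (hKV : K.toClosedSubmodule ≤ V.toClosedSubmodule)
    (u : tomitaDomain V) (x : tomitaDomain K.symplComp) (t : ℝ) :
    inclusionKernel DK DV u x ((2⁻¹ : ℂ) * I + t) =
      ⟪(u : H), DV.J (DV.U.appReal (-t) (DK.U.appReal t (DK.J x)))⟫_ℂ := by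
  have hrefl : -conj ((2⁻¹ : ℂ) * I + t) = (2⁻¹ : ℂ) * I + ((-t : ℝ) : ℂ) := by
    rw [map_add, map_mul, conj_I, conj_ofReal, show conj (2⁻¹ : ℂ) = 2⁻¹ by
      rw [show (2⁻¹ : ℂ) = ((2⁻¹ : ℝ) : ℂ) by push_cast; ring, conj_ofReal]]
    push_cast; ring
  -- Step 0: the two edge vectors
  have h0 : inclusionKernel DK DV u x ((2⁻¹ : ℂ) * I + t) =
      ⟪DV.U.appReal t (DV.J (tomitaOperator V u)),
        DK.U.appReal t (DK.J (tomitaOperator K.symplComp x))⟫_ℂ := by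
    rw [inclusionKernel, hrefl, DV.polarExt_ofReal_add_half_I, DK.symplComp.polarExt_ofReal_add_half_I,
      neg_neg, DK.symplComp_U_appReal, neg_neg, DK.symplComp_J]
  -- membership facts
  have hu₁ : DV.U.appReal t u ∈ tomitaDomain V := DV.U_apply_mem_tomitaDomain t u.2
  have hb : DK.U.appReal t (DK.J x) ∈ tomitaDomain K :=
    DK.U_apply_mem_tomitaDomain t (DK.J_apply_mem_tomitaDomain x.2)
  have hbV : DK.U.appReal t (DK.J x) ∈ tomitaDomain V := tomitaDomain_mono hKV hb
  have hA' : DV.J (tomitaOperator V ⟨DV.U.appReal t u, hu₁⟩) ∈ tomitaDomain V.symplComp :=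
    DV.J_apply_mem_tomitaDomain_symplComp (tomitaOperator_mem_domain _)
  -- `Δ_V^{it} J_V S_V u = J_V S_V u₁`, `u₁ = Δ_V^{it} u`
  have hA : DV.U.appReal t (DV.J (tomitaOperator V u)) =
      DV.J (tomitaOperator V ⟨DV.U.appReal t u, hu₁⟩) := by
    rw [← DV.J_U, DV.tomitaOperator_U_apply]
  -- `Δ_K^{it} J_K S_{K'} x = S_K b`, `b = Δ_K^{it} J_K x ∈ D(S_K)`
  have hB : DK.U.appReal t (DK.J (tomitaOperator K.symplComp x)) =
      tomitaOperator K ⟨DK.U.appReal t (DK.J x), hb⟩ := by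
    rw [← DK.tomitaOperator_J_of_mem_symplComp x, ← DK.tomitaOperator_U_apply t]
  -- `S_{V'} (J_V S_V u₁) = J_V u₁`
  have hSa : tomitaOperator V.symplComp ⟨DV.J (tomitaOperator V ⟨DV.U.appReal t u, hu₁⟩), hA'⟩ =
      DV.J (DV.U.appReal t u) := by
    have h1 := DV.tomitaOperator_symplComp_J
      ⟨tomitaOperator V ⟨DV.U.appReal t u, hu₁⟩, tomitaOperator_mem_domain _⟩
    have h2 : tomitaOperator V (⟨tomitaOperator V ⟨DV.U.appReal t u, hu₁⟩,
        tomitaOperator_mem_domain _⟩ : tomitaDomain V) = DV.U.appReal t u :=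
      tomitaOperator_tomitaOperator (⟨DV.U.appReal t u, hu₁⟩ : tomitaDomain V)
    rw [h2] at h1
    exact h1
  -- `⟪J_V S_V u₁, S_K b⟫ = ⟪S_{V'} (S_{V'} a), S_V b⟫ = ⟪b, S_{V'} a⟫ = ⟪b, J_V u₁⟫`
  have key : ⟪DV.J (tomitaOperator V ⟨DV.U.appReal t u, hu₁⟩),
      tomitaOperator K ⟨DK.U.appReal t (DK.J x), hb⟩⟫_ℂ =
      ⟪DK.U.appReal t (DK.J x), DV.J (DV.U.appReal t u)⟫_ℂ := by
    have hmemSa : tomitaOperator V.symplComp ⟨DV.J (tomitaOperator V ⟨DV.U.appReal t u, hu₁⟩), hA'⟩ ∈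
        tomitaDomain V.symplComp := tomitaOperator_mem_domain _
    have k := inner_tomitaOperator_symplComp_tomitaOperator
      (⟨tomitaOperator V.symplComp ⟨DV.J (tomitaOperator V ⟨DV.U.appReal t u, hu₁⟩), hA'⟩, hmemSa⟩ :
        tomitaDomain V.symplComp)
      (⟨DK.U.appReal t (DK.J x), hbV⟩ : tomitaDomain V)
    have hSSa : tomitaOperator V.symplComp
        (⟨tomitaOperator V.symplComp ⟨DV.J (tomitaOperator V ⟨DV.U.appReal t u, hu₁⟩), hA'⟩, hmemSa⟩ :
          tomitaDomain V.symplComp) =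
        (⟨DV.J (tomitaOperator V ⟨DV.U.appReal t u, hu₁⟩), hA'⟩ : tomitaDomain V.symplComp) :=
      tomitaOperator_tomitaOperator _
    have hSb : tomitaOperator V (⟨DK.U.appReal t (DK.J x), hbV⟩ : tomitaDomain V) =
        tomitaOperator K ⟨DK.U.appReal t (DK.J x), hb⟩ := tomitaOperator_eq_of_le hKV ⟨_, hb⟩
    dsimp only at k
    rw [hSSa, hSb, hSa] at k
    exact k
  rw [h0, hA, hB, key, DV.J_U, ModularData.inner_appReal_right_eq DV.U t,
    ← DV.inner_J_J (DV.J (u : H)), DV.J_J]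

/-- **Real-line bound**: `|g(t)| ≤ ‖u‖ ‖x‖`. [cite: Longo2008LecturesConformalNets, Thm. 2.3.1 (proof)] -/
theorem norm_inclusionKernel_ofReal_le (u : tomitaDomain V) (x : tomitaDomain K.symplComp) (t : ℝ) :
    ‖inclusionKernel DK DV u x t‖ ≤ ‖(u : H)‖ * ‖(x : H)‖ := by
  rw [inclusionKernel_ofReal]
  refine (norm_inner_le_norm _ _).trans ?_
  rw [DV.norm_U_apply, DK.norm_U_apply]

/-- **Upper-edge bound**: `|g(t + i/2)| ≤ ‖u‖ ‖x‖`. [cite: Longo2008LecturesConformalNets, Thm. 2.3.1 (proof)] -/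
theorem norm_inclusionKernel_half_I_add_ofReal_le (hKV : K.toClosedSubmodule ≤ V.toClosedSubmodule)
    (u : tomitaDomain V) (x : tomitaDomain K.symplComp) (t : ℝ) :
    ‖inclusionKernel DK DV u x ((2⁻¹ : ℂ) * I + t)‖ ≤ ‖(u : H)‖ * ‖(x : H)‖ := by
  rw [inclusionKernel_half_I_add_ofReal hKV]
  refine (norm_inner_le_norm _ _).trans ?_
  rw [LinearIsometryEquiv.norm_map, DV.norm_U_apply, DK.norm_U_apply, LinearIsometryEquiv.norm_map]

/-- **The three-lines bound `|g(z)| ≤ ‖u‖ ‖x‖`** everywhere (Phragmén–Lindelöf between the two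
edges; off the strip the kernel vanishes) (Longo, proof of Thm. 2.3.1: "by the Three Line Theorem,
`‖f_{ξ,η}(z)‖ ≤ ‖T‖ ‖ξ‖ ‖η‖`"). [cite: Longo2008LecturesConformalNets, Thm. 2.3.1 (proof)] -/
theorem norm_inclusionKernel_le (hKV : K.toClosedSubmodule ≤ V.toClosedSubmodule)
    (u : tomitaDomain V) (x : tomitaDomain K.symplComp) (z : ℂ) :
    ‖inclusionKernel DK DV u x z‖ ≤ ‖(u : H)‖ * ‖(x : H)‖ := by
  by_cases hz : z ∈ closedStrip 2⁻¹
  · refine norm_le_of_forall_mem_edges_strip (by norm_num : (0 : ℝ) < 2⁻¹)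
      (differentiableOn_inclusionKernel u x) (continuousOn_inclusionKernel u x)
      (fun w _ => norm_inclusionKernel_le_aux u x w) (fun w hw => ?_) (fun w hw => ?_) hz
    · obtain ⟨s, rfl⟩ : ∃ s : ℝ, (s : ℂ) = w := ⟨w.re, Complex.ext (by simp) (by simp [hw])⟩
      exact norm_inclusionKernel_ofReal_le u x s
    · obtain ⟨s, rfl⟩ : ∃ s : ℝ, (2⁻¹ : ℂ) * I + s = w :=
        ⟨w.re, Complex.ext (by simp) (by rw [add_im, half_I_im, ofReal_im, add_zero, hw])⟩
      exact norm_inclusionKernel_half_I_add_ofReal_le hKV u x s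
  · rw [inclusionKernel_of_not_mem u x hz, norm_zero]
    positivity

/-- The kernel is additive in `u`. [folklore] -/
theorem inclusionKernel_add_left (u u' : tomitaDomain V) (x : tomitaDomain K.symplComp) (z : ℂ) :
    inclusionKernel DK DV (u + u') x z = inclusionKernel DK DV u x z + inclusionKernel DK DV u' x z := by
  simp only [inclusionKernel, DV.polarExt_add, inner_add_left]

/-- The kernel is conjugate-homogeneous in `u`. [folklore] -/
theorem inclusionKernel_smul_left (c : ℂ) (u : tomitaDomain V) (x : tomitaDomain K.symplComp) (z : ℂ) :
    inclusionKernel DK DV (c • u) x z = conj c * inclusionKernel DK DV u x z := by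
  simp only [inclusionKernel, DV.polarExt_smul, inner_smul_left]

/-- The kernel is additive in `x`. [folklore] -/
theorem inclusionKernel_add_right (u : tomitaDomain V) (x x' : tomitaDomain K.symplComp) (z : ℂ) :
    inclusionKernel DK DV u (x + x') z = inclusionKernel DK DV u x z + inclusionKernel DK DV u x' z := by
  simp only [inclusionKernel, DK.symplComp.polarExt_add, inner_add_right]

/-- The kernel is homogeneous in `x`. [folklore] -/
theorem inclusionKernel_smul_right (c : ℂ) (u : tomitaDomain V) (x : tomitaDomain K.symplComp) (z : ℂ) :
    inclusionKernel DK DV u (c • x) z = c * inclusionKernel DK DV u x z := by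
  simp only [inclusionKernel, DK.symplComp.polarExt_smul, inner_smul_right]

/-- **Covariance of the kernel**: `g_{u,x}(z + s) = g_{Δ_V^{is} u, Δ_K^{is} x}(z)` on the strip.
[cite: Longo2008LecturesConformalNets, Thm. 2.3.1 (2.3.3)] -/
theorem inclusionKernel_add_ofReal (u : tomitaDomain V) (x : tomitaDomain K.symplComp) (s : ℝ) {z : ℂ}
    (hz : z ∈ closedStrip 2⁻¹) :
    inclusionKernel DK DV u x (z + s) = inclusionKernel DK DV
      ⟨DV.U.appReal s u, DV.U_apply_mem_tomitaDomain s u.2⟩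
      ⟨DK.symplComp.U.appReal (-s) x, DK.symplComp.U_apply_mem_tomitaDomain (-s) x.2⟩ z := by
  rw [inclusionKernel, inclusionKernel, DV.polarExt_U, DK.symplComp.polarExt_U,
    show -conj (z + (s : ℂ)) = -conj z + ((-s : ℝ) : ℂ) by rw [map_add, conj_ofReal]; push_cast; ring,
    DV.polarExt_add_ofReal u (-s) (neg_conj_mem_closedStrip_iff.2 hz), neg_neg,
    DK.symplComp.polarExt_add_ofReal x s hz]

end Kernel

/-! ### The operators `W(z) = Δ_V^{-iz} Δ_K^{iz}` -/

section Family

variable [CompleteSpace H] {K V : StandardSubspace H} (DK : ModularData K) (DV : ModularData V)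

omit [CompleteSpace H] in
/-- The subspace `D(S)` has dense range inclusion. [folklore] -/
theorem denseRange_tomitaDomain_subtype (V : StandardSubspace H) :
    DenseRange ((tomitaDomain V).subtype : tomitaDomain V → H) :=
  (dense_tomitaDomain V).denseRange_val

/-- Step 1 of the construction of `W(z)`: for fixed `z` and `x ∈ D(S_{K'})`, the linear functional
`u ↦ conj g_{u,x}(z)` on `D(S_V)`. [cite: Longo2008LecturesConformalNets, Thm. 2.3.1 (proof)] -/
def inclusionFunctional (x : tomitaDomain K.symplComp) (z : ℂ) : tomitaDomain V →ₗ[ℂ] ℂ where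
  toFun u := conj (inclusionKernel DK DV u x z)
  map_add' u u' := by simp only [inclusionKernel_add_left, map_add]
  map_smul' c u := by
    simp only [inclusionKernel_smul_left, map_mul, conj_conj, smul_eq_mul, RingHom.id_apply]

/-- Unfolding `inclusionFunctional`. [folklore] -/
theorem inclusionFunctional_apply (x : tomitaDomain K.symplComp) (z : ℂ) (u : tomitaDomain V) :
    inclusionFunctional DK DV x z u = conj (inclusionKernel DK DV u x z) := rfl

/-- The functional is bounded by `‖x‖`. [cite: Longo2008LecturesConformalNets, Thm. 2.3.1 (proof)] -/
theorem norm_inclusionFunctional_le (hKV : K.toClosedSubmodule ≤ V.toClosedSubmodule)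
    (x : tomitaDomain K.symplComp) (z : ℂ) (u : tomitaDomain V) :
    ‖inclusionFunctional DK DV x z u‖ ≤ ‖(x : H)‖ * ‖(tomitaDomain V).subtype u‖ := by
  rw [inclusionFunctional_apply, RCLike.norm_conj, mul_comm, Submodule.subtype_apply]
  exact norm_inclusionKernel_le hKV u x z

/-- Step 2: the bounded extension of the functional to `H`. [folklore] -/
def inclusionFunctionalExt (x : tomitaDomain K.symplComp) (z : ℂ) : H →L[ℂ] ℂ :=
  (inclusionFunctional DK DV x z).extendOfNorm (tomitaDomain V).subtype

/-- Step 3: the vector `ω(z, x) = W(z) x` (Riesz representative): `⟪u, ω⟫ = g_{u,x}(z)` for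
`u ∈ D(S_V)`. [cite: Longo2008LecturesConformalNets, Thm. 2.3.1 (proof)] -/
def inclusionVec (x : tomitaDomain K.symplComp) (z : ℂ) : H :=
  (InnerProductSpace.toDual ℂ H).symm (inclusionFunctionalExt DK DV x z)

/-- The extended functional agrees with the functional on `D(S_V)`. [folklore] -/
theorem inclusionFunctionalExt_apply (hKV : K.toClosedSubmodule ≤ V.toClosedSubmodule)
    (x : tomitaDomain K.symplComp) (z : ℂ) (u : tomitaDomain V) :
    inclusionFunctionalExt DK DV x z u = conj (inclusionKernel DK DV u x z) := by
  rw [inclusionFunctionalExt, ← Submodule.subtype_apply, LinearMap.extendOfNorm_eq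
    (denseRange_tomitaDomain_subtype V) ⟨‖(x : H)‖, norm_inclusionFunctional_le DK DV hKV x z⟩,
    inclusionFunctional_apply]

/-- The extended functional is bounded by `‖x‖`. [folklore] -/
theorem norm_inclusionFunctionalExt_le (hKV : K.toClosedSubmodule ≤ V.toClosedSubmodule)
    (x : tomitaDomain K.symplComp) (z : ℂ) : ‖inclusionFunctionalExt DK DV x z‖ ≤ ‖(x : H)‖ :=
  ContinuousLinearMap.opNorm_le_bound _ (norm_nonneg _) fun v =>
    LinearMap.norm_extendOfNorm_apply_le (denseRange_tomitaDomain_subtype V) _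
      (norm_inclusionFunctional_le DK DV hKV x z) v

/-- **Defining property of `ω(z, x)`**: `⟪u, ω(z, x)⟫ = g_{u,x}(z)` for `u ∈ D(S_V)`.
[cite: Longo2008LecturesConformalNets, Thm. 2.3.1 (proof)] -/
theorem inner_inclusionVec (hKV : K.toClosedSubmodule ≤ V.toClosedSubmodule)
    (u : tomitaDomain V) (x : tomitaDomain K.symplComp) (z : ℂ) :
    ⟪(u : H), inclusionVec DK DV x z⟫_ℂ = inclusionKernel DK DV u x z := by
  rw [inclusionVec, ← inner_conj_symm, InnerProductSpace.toDual_symm_apply,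
    inclusionFunctionalExt_apply DK DV hKV, conj_conj]

/-- `‖ω(z, x)‖ ≤ ‖x‖`. [cite: Longo2008LecturesConformalNets, Thm. 2.3.1 (2.3.2)] -/
theorem norm_inclusionVec_le (hKV : K.toClosedSubmodule ≤ V.toClosedSubmodule)
    (x : tomitaDomain K.symplComp) (z : ℂ) : ‖inclusionVec DK DV x z‖ ≤ ‖(x : H)‖ := by
  rw [inclusionVec, LinearIsometryEquiv.norm_map]
  exact norm_inclusionFunctionalExt_le DK DV hKV x z

/-- `ω(z, ·)` is additive. [folklore] -/
theorem inclusionVec_add (hKV : K.toClosedSubmodule ≤ V.toClosedSubmodule)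
    (x x' : tomitaDomain K.symplComp) (z : ℂ) :
    inclusionVec DK DV (x + x') z = inclusionVec DK DV x z + inclusionVec DK DV x' z := by
  refine (dense_tomitaDomain V).eq_of_inner_right ℂ fun u hu => ?_
  rw [inner_add_right, inner_inclusionVec DK DV hKV ⟨u, hu⟩, inner_inclusionVec DK DV hKV ⟨u, hu⟩,
    inner_inclusionVec DK DV hKV ⟨u, hu⟩, inclusionKernel_add_right]

/-- `ω(z, ·)` is homogeneous. [folklore] -/
theorem inclusionVec_smul (hKV : K.toClosedSubmodule ≤ V.toClosedSubmodule)
    (c : ℂ) (x : tomitaDomain K.symplComp) (z : ℂ) :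
    inclusionVec DK DV (c • x) z = c • inclusionVec DK DV x z := by
  refine (dense_tomitaDomain V).eq_of_inner_right ℂ fun u hu => ?_
  rw [inner_smul_right, inner_inclusionVec DK DV hKV ⟨u, hu⟩, inner_inclusionVec DK DV hKV ⟨u, hu⟩,
    inclusionKernel_smul_right]

/-- Step 4: `x ↦ ω(z, x)` as a linear map on `D(S_{K'})`, bounded by `1`.
[cite: Longo2008LecturesConformalNets, Thm. 2.3.1 (proof)] -/
def inclusionPre (hKV : K.toClosedSubmodule ≤ V.toClosedSubmodule) (z : ℂ) :
    tomitaDomain K.symplComp →ₗ[ℂ] H where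
  toFun x := inclusionVec DK DV x z
  map_add' x x' := inclusionVec_add DK DV hKV x x' z
  map_smul' c x := inclusionVec_smul DK DV hKV c x z

/-- Unfolding `inclusionPre`. [folklore] -/
theorem inclusionPre_apply (hKV : K.toClosedSubmodule ≤ V.toClosedSubmodule) (z : ℂ)
    (x : tomitaDomain K.symplComp) : inclusionPre DK DV hKV z x = inclusionVec DK DV x z :=
  rfl

/-- The bound `‖ω(z, x)‖ ≤ 1 · ‖x‖` in the format of `LinearMap.extendOfNorm`. [folklore] -/
theorem norm_inclusionPre_le (hKV : K.toClosedSubmodule ≤ V.toClosedSubmodule) (z : ℂ)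
    (x : tomitaDomain K.symplComp) :
    ‖inclusionPre DK DV hKV z x‖ ≤ 1 * ‖(tomitaDomain K.symplComp).subtype x‖ := by
  rw [inclusionPre_apply, one_mul, Submodule.subtype_apply]
  exact norm_inclusionVec_le DK DV hKV x z

/-- **The operators `W(z) = Δ_V^{-iz} Δ_K^{iz}`** of an inclusion `K ⊆ V` of standard subspaces
(Longo Cor. 2.3.2), for every `z ∈ ℂ` (they vanish off the strip `0 ≤ Im z ≤ 1/2`): the bounded
extension of `x ↦ ω(z, x)` from `D(S_{K'})`. [cite: Longo2008LecturesConformalNets, Cor. 2.3.2] -/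
def inclusionFamily (hKV : K.toClosedSubmodule ≤ V.toClosedSubmodule) (z : ℂ) : H →L[ℂ] H :=
  (inclusionPre DK DV hKV z).extendOfNorm (tomitaDomain K.symplComp).subtype

variable (hKV : K.toClosedSubmodule ≤ V.toClosedSubmodule)

/-- `W(z) x = ω(z, x)` for `x ∈ D(S_{K'})`. [folklore] -/
theorem inclusionFamily_apply_coe (z : ℂ) (x : tomitaDomain K.symplComp) :
    inclusionFamily DK DV hKV z x = inclusionVec DK DV x z := by
  rw [inclusionFamily, ← Submodule.subtype_apply, LinearMap.extendOfNorm_eq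
    (denseRange_tomitaDomain_subtype K.symplComp) ⟨1, norm_inclusionPre_le DK DV hKV z⟩, inclusionPre_apply]

/-- **`‖W(z) v‖ ≤ ‖v‖`**. [cite: Longo2008LecturesConformalNets, Thm. 2.3.1 (2.3.2)] -/
theorem norm_inclusionFamily_apply_le (z : ℂ) (v : H) :
    ‖inclusionFamily DK DV hKV z v‖ ≤ ‖v‖ := by
  have h := LinearMap.norm_extendOfNorm_apply_le (denseRange_tomitaDomain_subtype K.symplComp) 1
    (norm_inclusionPre_le DK DV hKV z) v
  rwa [one_mul] at h

/-- **`‖W(z)‖ ≤ 1`** (Longo Thm. 2.3.1, (2.3.2)). [cite: Longo2008LecturesConformalNets, Thm. 2.3.1 (2.3.2)] -/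
theorem opNorm_inclusionFamily_le (z : ℂ) : ‖inclusionFamily DK DV hKV z‖ ≤ 1 :=
  ContinuousLinearMap.opNorm_le_bound _ zero_le_one fun v => by
    rw [one_mul]; exact norm_inclusionFamily_apply_le DK DV hKV z v

/-- **Matrix coefficients of `W(z)` on the dense domains**: `⟪u, W(z) x⟫ = g_{u,x}(z)` for
`u ∈ D(S_V)`, `x ∈ D(S_{K'})`. [cite: Longo2008LecturesConformalNets, Thm. 2.3.1 (proof)] -/
theorem inner_inclusionFamily (u : tomitaDomain V) (x : tomitaDomain K.symplComp) (z : ℂ) :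
    ⟪(u : H), inclusionFamily DK DV hKV z x⟫_ℂ = inclusionKernel DK DV u x z := by
  rw [inclusionFamily_apply_coe, inner_inclusionVec DK DV hKV]

omit [CompleteSpace H] in
/-- Two bounded operators agreeing on `D(S_{K'})` are equal. [folklore] -/
theorem clm_eq_of_eqOn_tomitaDomain (W : StandardSubspace H) {A B : H →L[ℂ] H}
    (h : ∀ x : tomitaDomain W, A x = B x) : A = B := by
  refine ContinuousLinearMap.ext_on (s := (tomitaDomain W : Set H)) ?_ fun x hx => h ⟨x, hx⟩
  rw [Submodule.span_eq]
  exact dense_tomitaDomain W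

/-- **Real values `W(t) = Δ_V^{-it} Δ_K^{it}`** (Longo Cor. 2.3.2: "`W(s) = Δ_H^{-is} Δ_K^{is}`").
[cite: Longo2008LecturesConformalNets, Cor. 2.3.2] -/
theorem inclusionFamily_ofReal (t : ℝ) :
    inclusionFamily DK DV hKV t = DV.U.appReal (-t) * DK.U.appReal t := by
  refine clm_eq_of_eqOn_tomitaDomain K.symplComp fun x => ?_
  refine (dense_tomitaDomain V).eq_of_inner_right ℂ fun u hu => ?_
  rw [inner_inclusionFamily DK DV hKV ⟨u, hu⟩, inclusionKernel_ofReal, mul_apply_eq_comp]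

/-- `W(0) = 1`. [cite: Longo2008LecturesConformalNets, Cor. 2.3.2] -/
theorem inclusionFamily_zero : inclusionFamily DK DV hKV 0 = 1 := by
  have h := inclusionFamily_ofReal DK DV hKV 0
  rwa [ofReal_zero, neg_zero, UnitaryRep.appReal_zero, UnitaryRep.appReal_zero, mul_one] at h

/-- **Upper-edge values `W(t + i/2) = J_V W(t) J_K`** (Longo Cor. 2.3.2: "`W(s + i/2) = J_H W(s) J_K`"),
pointwise since `J` is conjugate-linear. [cite: Longo2008LecturesConformalNets, Cor. 2.3.2] -/
theorem inclusionFamily_half_I_add_ofReal_apply (t : ℝ) (v : H) :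
    inclusionFamily DK DV hKV ((2⁻¹ : ℂ) * I + t) v =
      DV.J (DV.U.appReal (-t) (DK.U.appReal t (DK.J v))) := by
  -- both sides are continuous in `v` and agree on the dense `D(S_{K'})`
  have hcont₁ : Continuous fun v : H => inclusionFamily DK DV hKV ((2⁻¹ : ℂ) * I + t) v :=
    ContinuousLinearMap.continuous _
  have hcont₂ : Continuous fun v : H => DV.J (DV.U.appReal (-t) (DK.U.appReal t (DK.J v))) :=
    DV.J.continuous.comp ((DV.U.appReal (-t)).continuous.comp
      ((DK.U.appReal t).continuous.comp DK.J.continuous))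
  refine congrFun (Continuous.ext_on (dense_tomitaDomain K.symplComp) hcont₁ hcont₂ fun x hx => ?_) v
  refine (dense_tomitaDomain V).eq_of_inner_right ℂ fun u hu => ?_
  rw [inner_inclusionFamily DK DV hKV ⟨u, hu⟩ ⟨x, hx⟩, inclusionKernel_half_I_add_ofReal hKV]

/-- `W(z) = 0` off the closed strip (junk values). [folklore] -/
theorem inclusionFamily_of_not_mem {z : ℂ} (hz : z ∉ closedStrip 2⁻¹) :
    inclusionFamily DK DV hKV z = 0 := by
  refine clm_eq_of_eqOn_tomitaDomain K.symplComp fun x => ?_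
  refine (dense_tomitaDomain V).eq_of_inner_right ℂ fun u hu => ?_
  rw [inner_inclusionFamily DK DV hKV ⟨u, hu⟩, inclusionKernel_of_not_mem _ _ hz,
    zero_apply, inner_zero_right]

/-- **Covariance `W(z + s) = Δ_V^{-is} W(z) Δ_K^{is}`** (Longo Thm. 2.3.1, (2.3.3)).
[cite: Longo2008LecturesConformalNets, Thm. 2.3.1 (2.3.3)] -/
theorem inclusionFamily_add_ofReal (s : ℝ) {z : ℂ} (hz : z ∈ closedStrip 2⁻¹) :
    inclusionFamily DK DV hKV (z + s) =
      DV.U.appReal (-s) * inclusionFamily DK DV hKV z * DK.U.appReal s := by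
  refine clm_eq_of_eqOn_tomitaDomain K.symplComp fun x => ?_
  refine (dense_tomitaDomain V).eq_of_inner_right ℂ fun u hu => ?_
  rw [inner_inclusionFamily DK DV hKV ⟨u, hu⟩, inclusionKernel_add_ofReal _ _ s hz,
    ← inner_inclusionFamily DK DV hKV, mul_apply_eq_comp, mul_apply_eq_comp,
    ModularData.inner_appReal_right_eq DV.U (-s), neg_neg]
  simp only [ModularData.symplComp_U_appReal, neg_neg]

/-- The matrix coefficients `z ↦ ⟪u, W(z) x⟫`, `u ∈ D(S_V)`, `x ∈ D(S_{K'})`, are continuous on the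
closed strip. [cite: Longo2008LecturesConformalNets, Cor. 2.3.2] -/
theorem continuousOn_inner_inclusionFamily_coe (u : tomitaDomain V) (x : tomitaDomain K.symplComp) :
    ContinuousOn (fun z => ⟪(u : H), inclusionFamily DK DV hKV z x⟫_ℂ) (closedStrip 2⁻¹) := by
  simp only [inner_inclusionFamily DK DV hKV]
  exact continuousOn_inclusionKernel u x

/-- The matrix coefficients `z ↦ ⟪u, W(z) x⟫`, `u ∈ D(S_V)`, `x ∈ D(S_{K'})`, are holomorphic on the
open strip. [cite: Longo2008LecturesConformalNets, Cor. 2.3.2] -/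
theorem differentiableOn_inner_inclusionFamily_coe (u : tomitaDomain V) (x : tomitaDomain K.symplComp) :
    DifferentiableOn ℂ (fun z => ⟪(u : H), inclusionFamily DK DV hKV z x⟫_ℂ)
      (openStrip 2⁻¹) := by
  simp only [inner_inclusionFamily DK DV hKV]
  exact differentiableOn_inclusionKernel u x

/-- **Weak continuity of `W` on the closed strip** for all vectors (Longo Cor. 2.3.2: "`W` extends to
a strongly continuous map on `S̄_{1/2}`"; here the weak form, by density from the domains).
[cite: Longo2008LecturesConformalNets, Cor. 2.3.2] -/
theorem continuousOn_inner_inclusionFamily (a b : H) :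
    ContinuousOn (fun z => ⟪a, inclusionFamily DK DV hKV z b⟫_ℂ) (closedStrip 2⁻¹) :=
  Literature.Analysis.OperatorTheory.continuousOn_inner_of_dense (C := 1)
    (fun z _ => opNorm_inclusionFamily_le DK DV hKV z) (dense_tomitaDomain V) (dense_tomitaDomain K.symplComp)
    (fun u hu x hx => continuousOn_inner_inclusionFamily_coe DK DV hKV ⟨u, hu⟩ ⟨x, hx⟩) a b

/-- **Weak holomorphy of `W` on the open strip** for all vectors. [cite: Longo2008LecturesConformalNets, Cor. 2.3.2] -/
theorem differentiableOn_inner_inclusionFamily (a b : H) :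
    DifferentiableOn ℂ (fun z => ⟪a, inclusionFamily DK DV hKV z b⟫_ℂ) (openStrip 2⁻¹) :=
  Literature.Analysis.OperatorTheory.differentiableOn_inner_of_dense (C := 1) (isOpen_openStrip _)
    (fun z _ => opNorm_inclusionFamily_le DK DV hKV z) (dense_tomitaDomain V) (dense_tomitaDomain K.symplComp)
    (fun u hu x hx => differentiableOn_inner_inclusionFamily_coe DK DV hKV ⟨u, hu⟩ ⟨x, hx⟩) a b

/-- **`W` is holomorphic on the open strip in operator norm** (Longo Cor. 2.3.2: "analytic in
`S_{1/2}`"; weak holomorphy upgraded by `differentiableOn_of_forall_differentiableOn_inner`).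
[cite: Longo2008LecturesConformalNets, Cor. 2.3.2] -/
theorem differentiableOn_inclusionFamily :
    DifferentiableOn ℂ (inclusionFamily DK DV hKV) (openStrip 2⁻¹) :=
  Literature.Analysis.OperatorTheory.differentiableOn_of_forall_differentiableOn_inner (C := 1)
    (isOpen_openStrip _) (fun z _ => opNorm_inclusionFamily_le DK DV hKV z)
    (differentiableOn_inner_inclusionFamily DK DV hKV)

/-- Continuity of `z ↦ ⟪a(z), W(φ(z)) b(z)⟫` for norm-continuous vector functions `a`, `b` and a
continuous `φ` mapping into the closed strip (weak continuity plus `‖W‖ ≤ 1`). [folklore] -/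
theorem continuousOn_inner_inclusionFamily_comp {s : Set ℂ} {a b : ℂ → H} {φ : ℂ → ℂ}
    (ha : ContinuousOn a s) (hb : ContinuousOn b s) (hφ : ContinuousOn φ s)
    (hmaps : MapsTo φ s (closedStrip 2⁻¹)) :
    ContinuousOn (fun z => ⟪a z, inclusionFamily DK DV hKV (φ z) (b z)⟫_ℂ) s := by
  intro z₀ hz₀
  have h1 : Tendsto (fun z => ⟪a z₀, inclusionFamily DK DV hKV (φ z) (b z₀)⟫_ℂ) (𝓝[s] z₀)
      (𝓝 ⟪a z₀, inclusionFamily DK DV hKV (φ z₀) (b z₀)⟫_ℂ) :=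
    ((continuousOn_inner_inclusionFamily DK DV hKV (a z₀) (b z₀)).comp hφ hmaps) z₀ hz₀
  have ha₀ : Tendsto a (𝓝[s] z₀) (𝓝 (a z₀)) := ha z₀ hz₀
  have hb₀ : Tendsto b (𝓝[s] z₀) (𝓝 (b z₀)) := hb z₀ hz₀
  -- the bound
  have hbound : ∀ z, ‖⟪a z, inclusionFamily DK DV hKV (φ z) (b z)⟫_ℂ -
      ⟪a z₀, inclusionFamily DK DV hKV (φ z₀) (b z₀)⟫_ℂ‖ ≤
      1 * (‖a z - a z₀‖ * ‖b z‖ + ‖a z₀‖ * ‖b z - b z₀‖) +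
        ‖⟪a z₀, inclusionFamily DK DV hKV (φ z) (b z₀)⟫_ℂ -
          ⟪a z₀, inclusionFamily DK DV hKV (φ z₀) (b z₀)⟫_ℂ‖ := by
    intro z
    have hsplit : ⟪a z, inclusionFamily DK DV hKV (φ z) (b z)⟫_ℂ -
        ⟪a z₀, inclusionFamily DK DV hKV (φ z₀) (b z₀)⟫_ℂ =
        (⟪a z, inclusionFamily DK DV hKV (φ z) (b z)⟫_ℂ -
          ⟪a z₀, inclusionFamily DK DV hKV (φ z) (b z₀)⟫_ℂ) +
        (⟪a z₀, inclusionFamily DK DV hKV (φ z) (b z₀)⟫_ℂ -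
          ⟪a z₀, inclusionFamily DK DV hKV (φ z₀) (b z₀)⟫_ℂ) := by ring
    rw [hsplit]
    exact (norm_add_le _ _).trans (add_le_add
      (Literature.Analysis.OperatorTheory.norm_inner_apply_sub_inner_apply_le _
        (opNorm_inclusionFamily_le DK DV hKV (φ z)) (a z) (b z) (a z₀) (b z₀)) le_rfl)
  -- the bound tends to zero
  have hlim : Tendsto (fun z => 1 * (‖a z - a z₀‖ * ‖b z‖ + ‖a z₀‖ * ‖b z - b z₀‖) +
      ‖⟪a z₀, inclusionFamily DK DV hKV (φ z) (b z₀)⟫_ℂ -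
        ⟪a z₀, inclusionFamily DK DV hKV (φ z₀) (b z₀)⟫_ℂ‖) (𝓝[s] z₀) (𝓝 0) := by
    have t1 : Tendsto (fun z => ‖a z - a z₀‖) (𝓝[s] z₀) (𝓝 0) := by
      simpa using (ha₀.sub_const (a z₀)).norm
    have t2 : Tendsto (fun z => ‖b z‖) (𝓝[s] z₀) (𝓝 ‖b z₀‖) := hb₀.norm
    have t3 : Tendsto (fun z => ‖b z - b z₀‖) (𝓝[s] z₀) (𝓝 0) := by
      simpa using (hb₀.sub_const (b z₀)).norm
    have t4 : Tendsto (fun z => ‖⟪a z₀, inclusionFamily DK DV hKV (φ z) (b z₀)⟫_ℂ -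
        ⟪a z₀, inclusionFamily DK DV hKV (φ z₀) (b z₀)⟫_ℂ‖) (𝓝[s] z₀) (𝓝 0) := by
      simpa using (h1.sub_const ⟪a z₀, inclusionFamily DK DV hKV (φ z₀) (b z₀)⟫_ℂ).norm
    have := (((t1.mul t2).add (t3.const_mul ‖a z₀‖)).const_mul 1).add t4
    simpa using this
  exact tendsto_sub_nhds_zero_iff.1 (squeeze_zero_norm hbound hlim)

end Family

end StandardSubspace

end Literature.MathematicalPhysics.AQFT
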